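import Summits.BirchSwinnertonDyer.BirchSwinnertonDyer.Theorems.ErratumRoadFiveNonSurjCornerSerreLevelExact
import Literature.NumberTheory.DiophantineGeometry.ConductorAdditiveProofs
import Literature.NumberTheory.DiophantineGeometry.ConductorExponentLeEightProofs
import Literature.NumberTheory.DiophantineGeometry.ConductorExponentLeFiveProofs
import Literature.NumberTheory.DiophantineGeometry.ConductorExponentLeTwoProofs
import HarnessLib

/-!
# Route `ErratumRoadFive` (K2, `p ≥ 5`), crux `NonSurjCorner` (item stmt-BirchSwinnertonDyer-19065), child `NonSurjCornerTwinMuAn` (19948):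
# THE SERRE LEVEL OF A CORNER CLASS IS CONDUCTOR-SHAPED
# (cell `bsd-stepL`, WIDTH-LEVER lane B `bsd-stepL-corner5-p2` g11; `--supports stmt-BirchSwinnertonDyer-19948 --as helper`)

WHAT. By `…SerreLevelExact` the level `N = N(E[p] ⊗ k)` of a corner class (`p ≥ 5` multiplicative, NO (ram) prime) is the additive
part of `N_E`: `ord_q N = f_q(E)` at the additive primes `q` and `0` elsewhere. The tree's conductor bounds (Ogg–Saito shape of `f_q`:
`f_q ≥ 2` iff additive, `two_le_conductorExponent_iff_holds`; `f_q ≤ 8`, `f_3 ≤ 5`, `f_q ≤ 2` for `q ≥ 5` — Brumer–Kramer ∕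
Lockhart–Rosen–Silverman, `conductorExponent_le_eight_holds`, `…le_five_of_natGenerator_eq_three_holds`,
`…le_two_of_five_le_natGenerator_holds`, all PROVED in the tree) turn this into the SHAPE of the level:

* `factorization_serreLevel_baseChange_shape` — for every prime `q ∣ N`: `2 ≤ ord_q N ≤ 8`, `ord_3 N ≤ 5`, and `ord_q N = 2` if `q ≥ 5`;
* `sq_dvd_serreLevel_baseChange_of_dvd` — `N` is POWERFUL: `q ∣ N ⟹ q² ∣ N`.

WHY (lane B census by Serre level, HOME/corner5/g11): with `…SerreLevelExact.exists_newform_two_serreLevel_of_not_ram_of_dvd` (newform at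
the EXACT level `N`, Khare–Wintenberger BY NAME) every corner class at `p` is a class (g, ℘) of a weight-two newform `g` on `Γ₁(N)` with
`N = 2^a 3^b ∏ qᵢ²`, `a ∈ {0} ∪ [2, 8]`, `b ∈ {0} ∪ [2, 5]`, `qᵢ ≥ 5` distinct primes `≠ p` — the CONDUCTOR-SHAPED levels; the complete
list of candidate corner classes with `N_add ≤ B` is read off the newforms at the conductor-shaped levels `≤ B` (75 levels `≤ 4 000` at
`p = 5`, 113 levels `≤ 10⁴`), and g10's enumeration of all 3 199 levels `≤ 4 000` was 40× redundant. HONEST FRAMING: conditional only on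
Ogg–Saito for `(E, p)` BY NAME (as `…SerreLevelExact` §2); no `sorry`, no new definition, no new named fact; items 19065 ∕ 19948 NOT closed;
BSD proved for no curve. [cite: Kraus1997, p. 1143] [cite: BrumerKramer1994, Thm 6.2] [cite: Silverman1994, IV.10.4]
-/

set_option autoImplicit false
set_option linter.dupNamespace false

noncomputable section

open scoped Classical NumberField

open WeierstrassCurve Literature.NumberTheory Literature.NumberTheory.GaloisRepresentations
  Literature.NumberTheory.EllipticCurves Rat.HeightOneSpectrum IsDedekindDomain IsDedekindDomain.HeightOneSpectrum
  Literature.NumberTheory.Automorphic.BCDT Literature.NumberTheory.DiophantineGeometry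
  Literature.NumberTheory.EllipticCurves.Rank1Residual Literature.NumberTheory.GaloisRepresentations.ModPGaloisRep
  Summit.BirchSwinnertonDyer.Rank1Residual Summit.BirchSwinnertonDyer.Rank1Residual.X11b

namespace Summit.BirchSwinnertonDyer.BirchSwinnertonDyer.Theorems.NonSurjCornerSerreLevelExact

/-- **The Serre level of a corner class is conductor-shaped.** `E/ℚ` elliptic (globally minimal model), `p ≥ 5` a prime of multiplicative
reduction, NO (ram) prime, Ogg–Saito for `(E, p)` BY NAME, `ρ̄` a framed model of `E[p]`, `j : 𝔽_p → k`: for every prime `q` dividing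
`N = N(E[p] ⊗ k)`, `2 ≤ ord_q N ≤ 8`, `ord_q N ≤ 5` if `q = 3`, and `ord_q N = 2` if `q ≥ 5`. Proof: `ord_q N = ord_q N_E = f_q(E)` with `E`
additive at `q` (`factorization_serreLevel_baseChange_eq_of_not_ram`; `q ∣ N` rules out the other branch), then the tree's bounds on `f_q`.
[cite: Kraus1997, p. 1143] [cite: BrumerKramer1994, Thm 6.2] [cite: Silverman1994, IV.10.2(c) and IV.10.4] -/
theorem factorization_serreLevel_baseChange_shape (W : WeierstrassCurve ℚ) [W.IsElliptic] [W.IsGloballyMinimal]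
    (p : ℕ) [Fact p.Prime] (hp5 : 5 ≤ p) (hOS : W.artinConductorExponent_tate_eq_conductorExponent_of_isElliptic p)
    (hmultp : Mult W p) (hnram : ¬ Ram W p)
    {ρ : ModPGaloisRep ℚ (ZMod p) 2} (hρ : W.IsTorsionGaloisRep p ρ)
    {k : Type*} [Field k] [TopologicalSpace k] [IsTopologicalRing k] (j : ZMod p →+* k) (hj : Continuous j)
    (q : ℕ) [Fact q.Prime] (hqN : q ∣ serreLevel p (FramedRep.baseChange j hj ρ)) :
    2 ≤ (serreLevel p (FramedRep.baseChange j hj ρ)).factorization q ∧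
      (serreLevel p (FramedRep.baseChange j hj ρ)).factorization q ≤ 8 ∧
      (q = 3 → (serreLevel p (FramedRep.baseChange j hj ρ)).factorization q ≤ 5) ∧
      (5 ≤ q → (serreLevel p (FramedRep.baseChange j hj ρ)).factorization q = 2) := by
  classical
  have hq : q.Prime := Fact.out
  set N := serreLevel p (FramedRep.baseChange j hj ρ) with hN
  have hN0 : N ≠ 0 := fun h0 ↦
    not_dvd_serreLevel p (FramedRep.baseChange j hj ρ) (by rw [← hN, h0]; exact dvd_zero p)
  have hfac := factorization_serreLevel_baseChange_eq_of_not_ram W p hp5 hOS hmultp hnram hρ j hj q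
  -- `q ∣ N` forces the additive branch
  have hpos : 1 ≤ N.factorization q := (hq.dvd_iff_one_le_factorization hN0).mp hqN
  have hadd : ¬ W.HasGoodReductionAtPrime q ∧ ¬ W.HasMultiplicativeReductionAtPrime q := by
    by_contra h
    rw [← hN, if_neg h] at hfac
    omega
  rw [← hN, if_pos hadd] at hfac
  -- the places of `𝓞 ℚ` and of `ℤ` below `q`, and `ord_q N = f_q`
  set v : HeightOneSpectrum (𝓞 ℚ) := (primesEquiv (R := 𝓞 ℚ)).symm ⟨q, hq⟩ with hvdef
  have hv : (primesEquiv v : Nat.Primes) = ⟨q, hq⟩ := Equiv.apply_symm_apply _ _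
  set u : HeightOneSpectrum ℤ := (primesEquiv (R := ℤ)).symm ⟨q, hq⟩ with hudef
  have hu : natGenerator u = q := Rat.natGenerator_primesEquiv_symm ⟨q, hq⟩
  have hfu : N.factorization q = W.conductorExponent u := by
    rw [hfac, factorization_conductorNorm_primesEquiv_symm W ⟨q, hq⟩]
  have hvu : W.conductorExponent v = W.conductorExponent u := by
    rw [conductorExponent_ringOfIntegers_eq W v, hv]
  -- lower bound: additive at `v`
  have haddv : W.HasAdditiveReductionAt v := hasAdditiveReductionAt_ringOfIntegers_of_additive W q hadd.1 hadd.2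
  haveI : PerfectField (IsLocalRing.ResidueField (v.adicCompletionIntegers ℚ)) := PerfectField.ofFinite
  have h2 : 2 ≤ W.conductorExponent v := (two_le_conductorExponent_iff_holds v W).mpr haddv
  refine ⟨?_, ?_, ?_, ?_⟩
  · rw [hfu, ← hvu]; exact h2
  · rw [hfu]; exact conductorExponent_le_eight_holds W u
  · intro hq3
    rw [hfu]
    exact conductorExponent_le_five_of_natGenerator_eq_three_holds W u (by rw [hu, hq3])
  · intro hq5
    rw [hfu]
    refine le_antisymm (conductorExponent_le_two_of_five_le_natGenerator_holds W u (by rw [hu]; exact hq5)) ?_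
    rw [← hvu]; exact h2

/-- **The Serre level of a corner class is powerful**: under the hypotheses of `factorization_serreLevel_baseChange_shape`, `q ∣ N ⟹ q² ∣ N`
for `N = N(E[p] ⊗ k)` and every prime `q`. [cite: Kraus1997, p. 1143] [cite: Silverman1994, IV.10.2(c)] -/
theorem sq_dvd_serreLevel_baseChange_of_dvd (W : WeierstrassCurve ℚ) [W.IsElliptic] [W.IsGloballyMinimal]
    (p : ℕ) [Fact p.Prime] (hp5 : 5 ≤ p) (hOS : W.artinConductorExponent_tate_eq_conductorExponent_of_isElliptic p)
    (hmultp : Mult W p) (hnram : ¬ Ram W p)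
    {ρ : ModPGaloisRep ℚ (ZMod p) 2} (hρ : W.IsTorsionGaloisRep p ρ)
    {k : Type*} [Field k] [TopologicalSpace k] [IsTopologicalRing k] (j : ZMod p →+* k) (hj : Continuous j)
    (q : ℕ) [Fact q.Prime] (hqN : q ∣ serreLevel p (FramedRep.baseChange j hj ρ)) :
    q ^ 2 ∣ serreLevel p (FramedRep.baseChange j hj ρ) := by
  have hq : q.Prime := Fact.out
  have hN0 : serreLevel p (FramedRep.baseChange j hj ρ) ≠ 0 := fun h0 ↦
    not_dvd_serreLevel p (FramedRep.baseChange j hj ρ) (h0 ▸ dvd_zero p)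
  exact (hq.pow_dvd_iff_le_factorization hN0).mpr
    (factorization_serreLevel_baseChange_shape W p hp5 hOS hmultp hnram hρ j hj q hqN).1

/-- **The exact-level door, shaped.** On the corner locus of items 19065 ∕ 19948 (`p ≥ 5` multiplicative, `E[p]` irreducible, NO (ram) prime,
`p ∣ ord_p Δ_min`), granted `khare_wintenberger` and Ogg–Saito BY NAME: `E[p] ⊗ 𝔽̄_p ≅ ρ̄_f` for a newform `f ∈ S₂(Γ₁(N))` whose level
`N ∣ N_E`, `p ∤ N`, is CONDUCTOR-SHAPED — every prime `q ∣ N` has `2 ≤ ord_q N ≤ 8`, `ord_3 N ≤ 5`, `ord_q N = 2` for `q ≥ 5`. This is the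
statement the lane's census consumes: the candidate corner classes with additive conductor `≤ B` are among the classes (g, ℘ ∣ p) of the
newforms `g` at the conductor-shaped levels `N ≤ B` prime to `p`. [cite: KhareWintenberger2009, Thm. 1.2 and Thm. 9.1] [cite: Kraus1997, p. 1143]
[cite: BrumerKramer1994, Thm 6.2] -/
theorem exists_newform_two_conductorShapedLevel_of_not_ram_of_dvd
    (p : ℕ) [Fact p.Prime] [TopologicalSpace (AlgebraicClosure (ZMod p))] [DiscreteTopology (AlgebraicClosure (ZMod p))]
    (hKW : Literature.NumberTheory.Automorphic.khare_wintenberger p (AlgebraicClosure (ZMod p)))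
    (hOS : ∀ (W : WeierstrassCurve ℚ) (ℓ : ℕ) [Fact ℓ.Prime],
      W.artinConductorExponent_tate_eq_conductorExponent_of_isElliptic ℓ)
    (W : WeierstrassCurve ℚ) [W.IsElliptic] [W.IsGloballyMinimal]
    (hp5 : 5 ≤ p) (hmultp : Mult W p) (hirr : Irr W p) (hnram : ¬ Ram W p)
    (hpeu : p ∣ padicValInt p W.minimalDiscriminantInt)
    {ρ : ModPGaloisRep ℚ (ZMod p) 2} (hρ : W.IsTorsionGaloisRep p ρ) :
    ∃ (N : ℕ) (_ : NeZero N), N ∣ W.conductorNorm ℤ ∧ ¬ p ∣ N ∧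
      (∀ (q : ℕ) [Fact q.Prime], q ∣ N →
        2 ≤ N.factorization q ∧ N.factorization q ≤ 8 ∧ (q = 3 → N.factorization q ≤ 5) ∧
          (5 ≤ q → N.factorization q = 2)) ∧
      ∃ (f : CuspForm (CongruenceSubgroup.Gamma1 N) 2)
        (ιf : ModularForms.coeffCharIntegers f →+* AlgebraicClosure (ZMod p)),
        ModularForms.IsNewform1 f ∧ ModularForms.IsGaloisRepOfNewform1Int f ιf {q | q ∣ N * p}
          (FramedRep.baseChange (algebraMap (ZMod p) (AlgebraicClosure (ZMod p)))
            continuous_of_discreteTopology ρ) := by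
  obtain ⟨N, hNz, hNeq, -, hNdvd, hpN, f, ιf, hf, hgal⟩ :=
    exists_newform_two_serreLevel_of_not_ram_of_dvd p hKW hOS W hp5 hmultp hirr hnram hpeu hρ
  refine ⟨N, hNz, hNdvd, hpN, fun q _ hqN ↦ ?_, f, ιf, hf, hgal⟩
  subst hNeq
  exact factorization_serreLevel_baseChange_shape W p hp5 (hOS W p) hmultp hnram hρ _ _ q hqN

end Summit.BirchSwinnertonDyer.BirchSwinnertonDyer.Theorems.NonSurjCornerSerreLevelExact

end
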